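import Literature.Probability.Percolation.FoldingFibres
import Mathlib.Combinatorics.SetFamily.FourFunctions
import HarnessLib

/-!
# Harris' inequality holds fibre by fibre (Kleitman's lemma on each folding fibre)

Topic `Literature/Probability/Percolation` (the inhomogeneous product measure
`μ = prodBernoulli p` on `Set ι`, `ι` finite).  Theorems only, no definitions of notions, no named
facts.

`FoldingFibres.lean` writes a product `μ(A) μ(B)` as a positive combination, over the folding
fibres `(M, u)` (`M` = the disagreement set of two independent copies, `u` = their common value off
`M`), of the COUNTS `#{a : a \ M = u, a ∈ A, a ∆ M ∈ B}` ("configuration versus complement" on the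
cube `{0,1}^M`), and shows that fibrewise domination of such counts implies the product inequality
for every parameter vector (`prodBernoulli_real_mul_le_of_fibrewise`; Linusson 2011, Prop. 2.6,
van den Berg–Gandolfi 2013, Reimer 2000).

This file proves that **Harris' inequality is fibrewise**: for increasing `A, B` and EVERY fibre,
`#{a : a \ M = u, a ∈ A, a ∆ M ∈ B} ≤ #{a : a \ M = u, a ∈ A ∩ B}`
(`fibreCount_le_of_isUpperSet`), and for `A` increasing, `B` decreasing the reverse comparison
(`fibreCount_le_of_isUpperSet_isLowerSet`).  The fibre `F = {a : a \ M = u}` is a sublattice of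
`Set ι` (an interval `[u, u ∪ M]` when `u ∩ M = ∅`), the sections `A ∩ F`, `B ∩ F` are up-sets of
`F`, and the reflected section `{a ∈ F : a ∆ M ∈ B}` is a DOWN-set of `F` of the same size as
`B ∩ F` (the reflection `a ↦ a ∆ M` is an order-reversing involution of `F`).  The two counting
steps are then exactly **Kleitman's lemma** — an up-set and a down-set of a finite Boolean lattice
are negatively correlated, two up-sets positively correlated, under the counting measure
[Kleitman 1966; it is Harris 1960 for the uniform product measure] — which we derive on the
sublattice `F` from Daykin's inequality `#s · #t ≤ #(s ⊼ t) · #(s ⊻ t)` (Mathlib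
`Finset.le_card_infs_mul_card_sups`, valid in every finite distributive lattice).  As a corollary,
Harris' inequality for `prodBernoulli p` is re-derived through the folding identity
(`prodBernoulli_harris_via_fibres`, `prodBernoulli_harris_upper_lower_via_fibres`; the tree's
`prodBernoulli_harris` proves it by transport from `infinitePi_harris`).

Context (harness, 2026-08): in the "fibre programme" for conditional connection inequalities
(tripod exchange `C⁺` ↦ its fibrewise form `C⁺⁺`; the catalogue of percolation rows found
fibre-positive by exhaustive enumeration) this settles the Harris row as a theorem; the
van den Berg–Kesten/Reimer rows are fibrewise by Reimer's butterfly theorem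
(`reimer_flip_card_le`), while the fibrewise forms of the van den Berg–Häggström–Kahn rows remain
conjectural.

## References

* D. J. Kleitman, *Families of non-disjoint subsets*, J. Combin. Theory 1 (1966) 153–155
  [Kleitman1966] — the lemma `|𝒰 ∩ 𝒟| · 2ⁿ ≤ |𝒰| · |𝒟|` for an up-set `𝒰` and a down-set `𝒟`.
* T. E. Harris, *A lower bound for the critical probability in a certain percolation process*,
  Proc. Cambridge Philos. Soc. 56 (1960) 13–20, Lemma 4.1 [Harris1960].
* S. Linusson, *On percolation and the bunkbed conjecture*, Combin. Probab. Comput. 20 (2011)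
  103–117, Model `E₃` and Prop. 2.6 [Linusson2011] (fibrewise ⇒ all `p`).

## Mathlib / tree

Mathlib: `Finset.le_card_infs_mul_card_sups` (Daykin), `Finset.card_nbij'`,
`IsUpperSet`/`IsLowerSet` on `Set (Set ι)`; the full-cube case of the two counting lemmas is
Mathlib's `IsUpperSet.le_card_inter_finset` / `IsUpperSet.card_inter_le_finset`
(`Combinatorics/SetFamily/HarrisKleitman.lean`, stated for `Finset (Finset α)`).
Tree: `prodBernoulli_real_mul_le_of_fibrewise` (`FoldingFibres.lean`), `prodBernoulli_harris`
(`ProdBernoulliIndependence.lean`, the measure-theoretic proof).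
-/

noncomputable section

open MeasureTheory Set
open scoped symmDiff Classical FinsetFamily
open Literature.Probability.LatticeModels (prodBernoulli)

namespace Literature.Probability.Percolation

variable {ι : Type*} [Fintype ι]

namespace FoldingFibre

/-! ### The folding fibre as a sublattice of `Set ι` with an order-reversing involution -/

/-- The folding fibre over `(M, u)`: all configurations whose value off `M` is `u`.
[cite: Linusson2011, Prop. 2.6 (the minor obtained by contracting/deleting the agreed edges)] -/
def fibre (M u : Set ι) : Finset (Set ι) := Finset.univ.filter fun a => a \ M = u

/-- Membership in the folding fibre. [folklore] -/
theorem mem_fibre {M u a : Set ι} : a ∈ fibre M u ↔ a \ M = u := by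
  simp [fibre]

/-- Membership in the folding fibre, pointwise. [folklore] -/
theorem mem_fibre_iff {M u a : Set ι} : a ∈ fibre M u ↔ ∀ x, (x ∈ a ∧ x ∉ M ↔ x ∈ u) := by
  rw [mem_fibre, Set.ext_iff]
  simp only [Set.mem_sdiff]

/-- The fibre is closed under intersection. [folklore] -/
theorem inter_mem_fibre {M u a b : Set ι} (ha : a ∈ fibre M u) (hb : b ∈ fibre M u) :
    a ∩ b ∈ fibre M u := by
  rw [mem_fibre_iff] at ha hb ⊢
  intro x
  have h1 := ha x
  have h2 := hb x
  simp only [Set.mem_inter_iff]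
  tauto

/-- The fibre is closed under union. [folklore] -/
theorem union_mem_fibre {M u a b : Set ι} (ha : a ∈ fibre M u) (hb : b ∈ fibre M u) :
    a ∪ b ∈ fibre M u := by
  rw [mem_fibre_iff] at ha hb ⊢
  intro x
  have h1 := ha x
  have h2 := hb x
  simp only [Set.mem_union]
  tauto

/-- The reflection `a ↦ a ∆ M` ("complement inside the fibre") maps the fibre to itself.
[folklore] -/
theorem symmDiff_mem_fibre {M u a : Set ι} (ha : a ∈ fibre M u) : a ∆ M ∈ fibre M u := by
  rw [mem_fibre_iff] at ha ⊢
  intro x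
  have h1 := ha x
  rw [Set.mem_symmDiff]
  tauto

/-- The reflection is ORDER-REVERSING on the fibre. [folklore] -/
theorem symmDiff_subset_symmDiff_of_subset {M u a b : Set ι} (ha : a ∈ fibre M u)
    (hb : b ∈ fibre M u) (hab : a ⊆ b) : b ∆ M ⊆ a ∆ M := by
  rw [mem_fibre_iff] at ha hb
  intro x hx
  have h1 := ha x
  have h2 := hb x
  have h3 : x ∈ a → x ∈ b := fun h => hab h
  rw [Set.mem_symmDiff] at hx ⊢
  tauto

/-- The reflected section `{a ∈ F : a ∆ M ∈ B}` has the same size as the section `B ∩ F`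
(the reflection is an involution of the fibre). [folklore] -/
theorem card_filter_symmDiff_mem (M u : Set ι) (B : Set (Set ι)) :
    ((fibre M u).filter fun a => a ∆ M ∈ B).card = ((fibre M u).filter fun a => a ∈ B).card := by
  refine Finset.card_bij' (fun (a : Set ι) _ => a ∆ M) (fun (a : Set ι) _ => a ∆ M) ?_ ?_ ?_ ?_
  · intro a ha
    rw [Finset.mem_filter] at ha ⊢
    exact ⟨symmDiff_mem_fibre ha.1, ha.2⟩
  · intro a ha
    rw [Finset.mem_filter] at ha ⊢
    refine ⟨symmDiff_mem_fibre ha.1, ?_⟩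
    rw [symmDiff_symmDiff_cancel_right]
    exact ha.2
  · intro a _
    exact symmDiff_symmDiff_cancel_right M a
  · intro a _
    exact symmDiff_symmDiff_cancel_right M a

/-! ### Kleitman's lemma on the fibre, from Daykin's inequality -/

/-- **Kleitman's lemma on a folding fibre, up-set versus down-set**: if `P` is increasing and `Q`
decreasing along `⊆` inside the fibre `F`, then `#{a ∈ F : P a ∧ Q a} · #F ≤ #{a ∈ F : P a} · #{a ∈ F : Q a}`.
Proof: Daykin's inequality `#X · #F ≤ #(X ⊼ F) · #(X ⊻ F)` for `X = {P ∧ Q}` and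
`X ⊼ F ⊆ {Q}`, `X ⊻ F ⊆ {P}`. [cite: Kleitman1966, Lemma (up-set/down-set form)] -/
theorem card_filter_and_mul_card_le (M u : Set ι) (P Q : Set ι → Prop)
    (hP : ∀ a ∈ fibre M u, ∀ b ∈ fibre M u, a ⊆ b → P a → P b)
    (hQ : ∀ a ∈ fibre M u, ∀ b ∈ fibre M u, a ⊆ b → Q b → Q a) :
    ((fibre M u).filter fun a => P a ∧ Q a).card * (fibre M u).card ≤
      ((fibre M u).filter fun a => P a).card * ((fibre M u).filter fun a => Q a).card := by
  set F := fibre M u with hF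
  set X := F.filter fun a => P a ∧ Q a with hX
  have hD := Finset.le_card_infs_mul_card_sups X F
  have h1 : X ⊼ F ⊆ F.filter fun a => Q a := by
    intro c hc
    rw [Finset.mem_infs] at hc
    obtain ⟨x, hx, f, hf, rfl⟩ := hc
    rw [hX, Finset.mem_filter] at hx
    rw [Finset.mem_filter]
    have hxf : x ⊓ f ∈ F := inter_mem_fibre hx.1 hf
    exact ⟨hxf, hQ _ hxf _ hx.1 Set.inter_subset_left hx.2.2⟩
  have h2 : X ⊻ F ⊆ F.filter fun a => P a := by
    intro c hc
    rw [Finset.mem_sups] at hc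
    obtain ⟨x, hx, f, hf, rfl⟩ := hc
    rw [hX, Finset.mem_filter] at hx
    rw [Finset.mem_filter]
    have hxf : x ⊔ f ∈ F := union_mem_fibre hx.1 hf
    exact ⟨hxf, hP _ hx.1 _ hxf Set.subset_union_left hx.2.1⟩
  calc X.card * F.card ≤ (X ⊼ F).card * (X ⊻ F).card := hD
    _ ≤ (F.filter fun a => Q a).card * (F.filter fun a => P a).card :=
        Nat.mul_le_mul (Finset.card_le_card h1) (Finset.card_le_card h2)
    _ = (F.filter fun a => P a).card * (F.filter fun a => Q a).card := Nat.mul_comm _ _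

/-- **Kleitman's lemma on a folding fibre, two up-sets**: if `P` and `Q` are increasing along `⊆`
inside the fibre `F`, then `#{a ∈ F : P a} · #{a ∈ F : Q a} ≤ #F · #{a ∈ F : P a ∧ Q a}`.
Proof: Daykin's inequality for `s = {P}`, `t = {Q}`: `s ⊼ t ⊆ F`, `s ⊻ t ⊆ {P ∧ Q}`.
[cite: Kleitman1966, Lemma (two up-sets form)] -/
theorem card_filter_mul_card_filter_le (M u : Set ι) (P Q : Set ι → Prop)
    (hP : ∀ a ∈ fibre M u, ∀ b ∈ fibre M u, a ⊆ b → P a → P b)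
    (hQ : ∀ a ∈ fibre M u, ∀ b ∈ fibre M u, a ⊆ b → Q a → Q b) :
    ((fibre M u).filter fun a => P a).card * ((fibre M u).filter fun a => Q a).card ≤
      (fibre M u).card * ((fibre M u).filter fun a => P a ∧ Q a).card := by
  set F := fibre M u with hF
  set s := F.filter fun a => P a with hs
  set t := F.filter fun a => Q a with ht
  have hD := Finset.le_card_infs_mul_card_sups s t
  have h1 : s ⊼ t ⊆ F := by
    intro c hc
    rw [Finset.mem_infs] at hc
    obtain ⟨x, hx, y, hy, rfl⟩ := hc
    rw [hs, Finset.mem_filter] at hx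
    rw [ht, Finset.mem_filter] at hy
    exact inter_mem_fibre hx.1 hy.1
  have h2 : s ⊻ t ⊆ F.filter fun a => P a ∧ Q a := by
    intro c hc
    rw [Finset.mem_sups] at hc
    obtain ⟨x, hx, y, hy, rfl⟩ := hc
    rw [hs, Finset.mem_filter] at hx
    rw [ht, Finset.mem_filter] at hy
    rw [Finset.mem_filter]
    have hxy : x ⊔ y ∈ F := union_mem_fibre hx.1 hy.1
    exact ⟨hxy, hP _ hx.1 _ hxy Set.subset_union_left hx.2,
      hQ _ hy.1 _ hxy Set.subset_union_right hy.2⟩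
  calc s.card * t.card ≤ (s ⊼ t).card * (s ⊻ t).card := hD
    _ ≤ F.card * (F.filter fun a => P a ∧ Q a).card :=
        Nat.mul_le_mul (Finset.card_le_card h1) (Finset.card_le_card h2)

/-! ### Harris is fibrewise -/

/-- **Harris' inequality is fibrewise (increasing/increasing).**  For increasing events `A, B ⊆ Set ι`
and every folding fibre `(M, u)`:
`#{a : a \ M = u, a ∈ A, a ∆ M ∈ B} ≤ #{a : a \ M = u, a ∈ A ∩ B, a ∆ M ∈ univ}`,
i.e. the fibre count of `(A, B)` is at most that of `(A ∩ B, Ω)`.  Proof: with `F` the fibre,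
`X = {a ∈ F : a ∈ A, a ∆ M ∈ B}`, `#X · #F ≤ #(A ∩ F) · #{a ∈ F : a ∆ M ∈ B} = #(A ∩ F) · #(B ∩ F)
≤ #F · #(A ∩ B ∩ F)` — Kleitman's lemma twice (the reflected section of `B` is a down-set of `F` of
the size of `B ∩ F`). [cite: Kleitman1966, Lemma] [cite: Harris1960, Lemma 4.1 (uniform case)] -/
theorem fibreCount_le_of_isUpperSet {A B : Set (Set ι)} (hA : IsUpperSet A) (hB : IsUpperSet B)
    (M u : Set ι) :
    (Finset.univ.filter fun a : Set ι => a \ M = u ∧ a ∈ A ∧ a ∆ M ∈ B).card ≤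
      (Finset.univ.filter fun a : Set ι =>
        a \ M = u ∧ a ∈ A ∩ B ∧ a ∆ M ∈ (Set.univ : Set (Set ι))).card := by
  -- both counts live on the fibre `F`
  have e1 : (Finset.univ.filter fun a : Set ι => a \ M = u ∧ a ∈ A ∧ a ∆ M ∈ B) =
      (fibre M u).filter fun a => a ∈ A ∧ a ∆ M ∈ B := by
    ext a
    simp [fibre]
  have e2 : (Finset.univ.filter fun a : Set ι =>
        a \ M = u ∧ a ∈ A ∩ B ∧ a ∆ M ∈ (Set.univ : Set (Set ι))) =
      (fibre M u).filter fun a => a ∈ A ∧ a ∈ B := by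
    ext a
    simp [fibre]
  rw [e1, e2]
  set F := fibre M u with hF
  -- monotonicity data inside the fibre
  have hPA : ∀ a ∈ F, ∀ b ∈ F, a ⊆ b → a ∈ A → b ∈ A := fun a _ b _ hab ha => hA hab ha
  have hPB : ∀ a ∈ F, ∀ b ∈ F, a ⊆ b → a ∈ B → b ∈ B := fun a _ b _ hab ha => hB hab ha
  have hQB : ∀ a ∈ F, ∀ b ∈ F, a ⊆ b → b ∆ M ∈ B → a ∆ M ∈ B :=
    fun a ha b hb hab h => hB (symmDiff_subset_symmDiff_of_subset ha hb hab) h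
  -- step 1: up-set `A` against the down-set `{a ∆ M ∈ B}`
  have h1 := card_filter_and_mul_card_le M u (fun a => a ∈ A) (fun a => a ∆ M ∈ B) hPA hQB
  -- step 2: the reflected section has the size of `B ∩ F`
  have h2 := card_filter_symmDiff_mem M u B
  -- step 3: two up-sets
  have h3 := card_filter_mul_card_filter_le M u (fun a => a ∈ A) (fun a => a ∈ B) hPA hPB
  rw [← hF] at h1 h2 h3
  rw [h2] at h1
  -- combine: #X · #F ≤ #F · #(A ∩ B ∩ F)
  have h4 : (F.filter fun a => a ∈ A ∧ a ∆ M ∈ B).card * F.card ≤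
      F.card * (F.filter fun a => a ∈ A ∧ a ∈ B).card := h1.trans h3
  rcases Nat.eq_zero_or_pos F.card with hF0 | hFpos
  · -- empty fibre: both counts vanish
    have : (F.filter fun a => a ∈ A ∧ a ∆ M ∈ B).card = 0 :=
      Nat.eq_zero_of_le_zero ((Finset.card_le_card (Finset.filter_subset _ F)).trans hF0.le)
    rw [this]
    exact Nat.zero_le _
  · rw [Nat.mul_comm F.card] at h4
    exact Nat.le_of_mul_le_mul_right h4 hFpos

/-- **Harris' inequality is fibrewise (increasing/decreasing).**  For `A` increasing and `B`
decreasing and every folding fibre `(M, u)`: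
`#{a : a \ M = u, a ∈ A ∩ B, a ∆ M ∈ univ} ≤ #{a : a \ M = u, a ∈ A, a ∆ M ∈ B}`.
Proof: `#(A ∩ B ∩ F) · #F ≤ #(A ∩ F) · #(B ∩ F) = #(A ∩ F) · #{a ∈ F : a ∆ M ∈ B} ≤ #F · #X`,
Kleitman's lemma twice (now the reflected section of `B` is an UP-set of `F`).
[cite: Kleitman1966, Lemma] [cite: Harris1960, Lemma 4.1 (uniform case)] -/
theorem fibreCount_le_of_isUpperSet_isLowerSet {A B : Set (Set ι)} (hA : IsUpperSet A)
    (hB : IsLowerSet B) (M u : Set ι) :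
    (Finset.univ.filter fun a : Set ι =>
        a \ M = u ∧ a ∈ A ∩ B ∧ a ∆ M ∈ (Set.univ : Set (Set ι))).card ≤
      (Finset.univ.filter fun a : Set ι => a \ M = u ∧ a ∈ A ∧ a ∆ M ∈ B).card := by
  have e1 : (Finset.univ.filter fun a : Set ι => a \ M = u ∧ a ∈ A ∧ a ∆ M ∈ B) =
      (fibre M u).filter fun a => a ∈ A ∧ a ∆ M ∈ B := by
    ext a
    simp [fibre]
  have e2 : (Finset.univ.filter fun a : Set ι =>
        a \ M = u ∧ a ∈ A ∩ B ∧ a ∆ M ∈ (Set.univ : Set (Set ι))) =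
      (fibre M u).filter fun a => a ∈ A ∧ a ∈ B := by
    ext a
    simp [fibre]
  rw [e1, e2]
  set F := fibre M u with hF
  have hPA : ∀ a ∈ F, ∀ b ∈ F, a ⊆ b → a ∈ A → b ∈ A := fun a _ b _ hab ha => hA hab ha
  have hQB : ∀ a ∈ F, ∀ b ∈ F, a ⊆ b → b ∈ B → a ∈ B := fun a _ b _ hab hb' => hB hab hb'
  have hPB' : ∀ a ∈ F, ∀ b ∈ F, a ⊆ b → a ∆ M ∈ B → b ∆ M ∈ B :=
    fun a ha b hb hab h => hB (symmDiff_subset_symmDiff_of_subset ha hb hab) h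
  -- step 1: up-set `A` against the down-set `B`
  have h1 := card_filter_and_mul_card_le M u (fun a => a ∈ A) (fun a => a ∈ B) hPA hQB
  -- step 2: reflected section
  have h2 := card_filter_symmDiff_mem M u B
  -- step 3: two up-sets `A` and `{a ∆ M ∈ B}`
  have h3 := card_filter_mul_card_filter_le M u (fun a => a ∈ A) (fun a => a ∆ M ∈ B) hPA hPB'
  rw [← hF] at h1 h2 h3
  rw [← h2] at h1
  have h4 : (F.filter fun a => a ∈ A ∧ a ∈ B).card * F.card ≤
      F.card * (F.filter fun a => a ∈ A ∧ a ∆ M ∈ B).card := h1.trans h3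
  rcases Nat.eq_zero_or_pos F.card with hF0 | hFpos
  · have : (F.filter fun a => a ∈ A ∧ a ∈ B).card = 0 :=
      Nat.eq_zero_of_le_zero ((Finset.card_le_card (Finset.filter_subset _ F)).trans hF0.le)
    rw [this]
    exact Nat.zero_le _
  · rw [Nat.mul_comm F.card] at h4
    exact Nat.le_of_mul_le_mul_right h4 hFpos

end FoldingFibre

/-! ### Corollary: Harris' inequality for `prodBernoulli` through the folding identity -/

/-- **Harris' inequality re-derived fibre by fibre**: for increasing `A, B`,
`μ(A) μ(B) ≤ μ(A ∩ B)` for `μ = prodBernoulli p`, every `p : ι → [0,1]` — from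
`prodBernoulli_real_mul_le_of_fibrewise` and `fibreCount_le_of_isUpperSet`.  (Same statement as the
tree's `prodBernoulli_harris`, without measurability hypotheses, which are automatic on the finite
cube.) [cite: Harris1960, Lemma 4.1] [cite: Kleitman1966, Lemma] [cite: Linusson2011, Prop. 2.6] -/
theorem prodBernoulli_harris_via_fibres (p : ι → unitInterval) {A B : Set (Set ι)}
    (hA : IsUpperSet A) (hB : IsUpperSet B) :
    (prodBernoulli p).real A * (prodBernoulli p).real B ≤ (prodBernoulli p).real (A ∩ B) := by
  have h := prodBernoulli_real_mul_le_of_fibrewise p A B (A ∩ B) Set.univ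
    (fun M u _ => by convert FoldingFibre.fibreCount_le_of_isUpperSet hA hB M u)
  rwa [probReal_univ, mul_one] at h

/-- **Harris' inequality, increasing versus decreasing, fibre by fibre**: for `A` increasing and
`B` decreasing, `μ(A ∩ B) ≤ μ(A) μ(B)` for `μ = prodBernoulli p`.
[cite: Harris1960, Lemma 4.1] [cite: Kleitman1966, Lemma] [cite: Linusson2011, Prop. 2.6] -/
theorem prodBernoulli_harris_upper_lower_via_fibres (p : ι → unitInterval) {A B : Set (Set ι)}
    (hA : IsUpperSet A) (hB : IsLowerSet B) :
    (prodBernoulli p).real (A ∩ B) ≤ (prodBernoulli p).real A * (prodBernoulli p).real B := by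
  have h := prodBernoulli_real_mul_le_of_fibrewise p (A ∩ B) Set.univ A B
    (fun M u _ => by convert FoldingFibre.fibreCount_le_of_isUpperSet_isLowerSet hA hB M u)
  rwa [probReal_univ, mul_one] at h

end Literature.Probability.Percolation

end
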